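import Literature.AlgebraicGeometry.GroupSchemes.BTGroupUniformizerKernelRank
import HarnessLib

/-!
# The rank of ANY realisation of a kernel: `rk Γ(K) = rk Γ(Ker f)` for every monomorphism `K ↪ G` whose `T`-points are «killed by `f`»

Topic `AlgebraicGeometry/GroupSchemes`, namespace `Literature.AlgebraicGeometry.GroupSchemes`.  THEOREMS ONLY (no definition, no named fact, no
`instance`, no notation, no `sorry`).  Cell `hodgecm-mathlib` (D-0151), F0∕P6 «MOD», line «L2» (socket `stub_SPEC` of `Lines/F0_P6a_StubDOWN.lean`,
road [WQ] ∕ (C6′) ∕ (ρ1𝒞)), deal (RK) «RANK ROW ENGINE» (LA2-plan (g2) 2026-09-02T08:38:52Z → B-p08 (g35)); `--supports stmt-HodgeConjecture-24832`,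
count-neutral.

THE POINT ([GortzWedhorn2020] Definition 4.45 (2) p. 117: the kernel `Ker f = G ×_{H,e} S` REPRESENTS the functor `T ↦ Ker(G(T) → H(T))`; two objects
representing one subfunctor of `G` by monomorphisms are isomorphic OVER `G`).  The L2 consumers ((C6′) `hrkᵢ`, [WQ] `hrk₁∕hrk₂`, (ρ1𝒞) §B (RK)) state the rank
of «the kernel of the reduced leg `ψ`» BY VALUE FOR EVERY CLOSED REALISATION: «for every `κ : K ↪ A_x̄` with `(∃ s, s ≫ κ = t) ↔ t ≫ ψ = 1` on all `T`-points,
`rk_k Γ(K) = q·q`», whereas the producing organ (★ `RoofLegsSpecialFibreKernelRowsFin`, row (RK)) delivers `rk Γ(Ker ψ)` for THE scheme-theoretic kernel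
`GroupSchemeKernel.ker ψ`.  This file is the bridge, once and for all and over any base ring `R`:
* §1 `exists_iso_ker_of_points_iff` — such a `κ` is isomorphic to `Ker f` OVER `G` (★ `exists_iso_of_fac_of_fac` with `kerLift κ` and the lift of `ι_{Ker f}`);
* §2 `finrank_alg_eq_finrank_alg_ker_of_points_iff` (`rk Γ(K) = rk Γ(Ker f)`, ★ `Alg.finrank_eq_of_iso`), `finrank_alg_eq_of_points_iff_of_points_iff` (two
  realisations have the same rank), and the BY-VALUE heads `finrank_alg_eq_of_points_iff_of_finrank_ker_eq` (`[Mono κ]`) ∕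
  **`finrank_alg_realisation_eq_of_finrank_ker_eq`** (`[IsClosedImmersion κ.left]`, the consumers' binder shape verbatim).

## References
* [GortzWedhorn2020] U. Görtz, T. Wedhorn, *Algebraic Geometry I*, 2nd ed. (2020) — Definition 4.45 (2) (p. 117), Section (4.7).
* [Tate1997FiniteFlatGroupSchemes] J. Tate, *Finite flat group schemes*, in: Modular Forms and Fermat's Last Theorem (1997) — §(3.7) (p. 146).
* [Waterhouse1979] W. C. Waterhouse, *Introduction to Affine Group Schemes*, GTM 66 (1979) — §2.1 (kernels).
-/

set_option autoImplicit false

universe v u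

open CategoryTheory Limits MonoidalCategory CartesianMonoidalCategory AlgebraicGeometry

noncomputable section

namespace Literature.AlgebraicGeometry.GroupSchemes

open Literature.AlgebraicGeometry.Motives GroupSchemeKernel AffineGroupScheme
open scoped MonObj

variable {R : Type u} [CommRing R] {G H : SchemeOver R} [GrpObj H] (f : G ⟶ H) [HasPullback f η[H]]

/-! ## §1 A realisation of the kernel functor is isomorphic to `Ker f` over `G` -/

/-- **A monomorphism `κ : K ↪ G` whose `T`-points are exactly the points killed by `f` is ISOMORPHIC TO `Ker f` OVER `G`**: there is `e : K ≅ Ker f`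
with `e.hom ≫ ι_{Ker f} = κ` and `e.inv ≫ κ = ι_{Ker f}` (the two mutual factorisations are `kerLift κ` and the `κ`-lift of `ι_{Ker f}`, ★ `exists_iso_of_fac_of_fac`).
[cite: GortzWedhorn2020, Definition 4.45 (2) (p. 117)] -/
theorem exists_iso_ker_of_points_iff {K : SchemeOver R} (κ : K ⟶ G) [Mono κ]
    (hK : ∀ ⦃T : SchemeOver R⦄ (t : T ⟶ G), (∃ s : T ⟶ K, s ≫ κ = t) ↔ t ≫ f = 1) :
    ∃ e : K ≅ ker f, e.hom ≫ kerι f = κ ∧ e.inv ≫ κ = kerι f := by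
  haveI := mono_kerι f
  obtain ⟨v, hv⟩ := (hK (kerι f)).2 (kerι_comp f)
  exact exists_iso_of_fac_of_fac κ (kerι f) (kerLift κ ((hK κ).1 ⟨𝟙 K, Category.id_comp κ⟩)) (kerLift_ι _ _) v hv

/-! ## §2 Ranks -/

/-- **`rk_R Γ(K) = rk_R Γ(Ker f)`** for every monomorphic realisation `κ : K ↪ G` of the kernel functor of `f` (§1 + ★ `Alg.finrank_eq_of_iso`).
[cite: GortzWedhorn2020, Definition 4.45 (2) (p. 117), Section (4.7)] [cite: Tate1997FiniteFlatGroupSchemes, §(3.7) (p. 146)] -/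
theorem finrank_alg_eq_finrank_alg_ker_of_points_iff {K : SchemeOver R} (κ : K ⟶ G) [Mono κ]
    (hK : ∀ ⦃T : SchemeOver R⦄ (t : T ⟶ G), (∃ s : T ⟶ K, s ≫ κ = t) ↔ t ≫ f = 1) :
    Module.finrank R (Alg K) = Module.finrank R (Alg (ker f)) := by
  obtain ⟨e, -, -⟩ := exists_iso_ker_of_points_iff f κ hK
  exact Alg.finrank_eq_of_iso e

/-- **Two realisations of one kernel have the same rank.** [cite: GortzWedhorn2020, Definition 4.45 (2) (p. 117)] [cite: Tate1997FiniteFlatGroupSchemes, §(3.7) (p. 146)] -/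
theorem finrank_alg_eq_of_points_iff_of_points_iff {K K' : SchemeOver R} (κ : K ⟶ G) [Mono κ] (κ' : K' ⟶ G) [Mono κ']
    (hK : ∀ ⦃T : SchemeOver R⦄ (t : T ⟶ G), (∃ s : T ⟶ K, s ≫ κ = t) ↔ t ≫ f = 1)
    (hK' : ∀ ⦃T : SchemeOver R⦄ (t : T ⟶ G), (∃ s : T ⟶ K', s ≫ κ' = t) ↔ t ≫ f = 1) :
    Module.finrank R (Alg K) = Module.finrank R (Alg K') := by
  rw [finrank_alg_eq_finrank_alg_ker_of_points_iff f κ hK, finrank_alg_eq_finrank_alg_ker_of_points_iff f κ' hK']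

/-- **BY VALUE**: if `rk_R Γ(Ker f) = n` then EVERY monomorphic realisation of the kernel has `rk_R Γ(K) = n`.
[cite: GortzWedhorn2020, Definition 4.45 (2) (p. 117)] [cite: Tate1997FiniteFlatGroupSchemes, §(3.7) (p. 146)] -/
theorem finrank_alg_eq_of_points_iff_of_finrank_ker_eq {n : ℕ} (hn : Module.finrank R (Alg (ker f)) = n)
    {K : SchemeOver R} (κ : K ⟶ G) [Mono κ]
    (hK : ∀ ⦃T : SchemeOver R⦄ (t : T ⟶ G), (∃ s : T ⟶ K, s ≫ κ = t) ↔ t ≫ f = 1) :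
    Module.finrank R (Alg K) = n :=
  (finrank_alg_eq_finrank_alg_ker_of_points_iff f κ hK).trans hn

/-- **(RK) ENGINE — THE CONSUMERS' SHAPE** (cell `hodgecm-mathlib` L2 (C6′) `hrkᵢ` ∕ [WQ] `hrk₁ hrk₂` ∕ (ρ1𝒞) §B row (RK), binders verbatim: a CLOSED IMMERSION `κ`
which is a homomorphism of affine finite group schemes): if `rk_R Γ(Ker f) = n` then for every `K` and every closed immersion `κ : K ↪ G` with
`(∃ s, s ≫ κ = t) ↔ t ≫ f = 1` on all `T`-points, `rk_R Γ(K) = n` (a closed immersion is a monomorphism of schemes, hence of `R`-schemes: Mathlib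
`IsPreimmersion → Mono` + `Over.mono_of_mono_left`).  The L2 instance: `f := ψ` (the reduced leg at `x̄`), `n := q·q` from ★ (RK) of
`RoofLegsSpecialFibreKernelRowsFin` (`rk Γ(Ker ψ) = #Ker q(Ω̄)`) and the upstairs count `#Ker q(Ω̄) = #K = q²` (L2 (ρ2‴)).
[cite: GortzWedhorn2020, Definition 4.45 (2) (p. 117), Section (4.7)] [cite: Tate1997FiniteFlatGroupSchemes, §(3.7) (p. 146)] -/
theorem finrank_alg_realisation_eq_of_finrank_ker_eq [GrpObj G] {n : ℕ} (hn : Module.finrank R (Alg (ker f)) = n)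
    (K : SchemeOver R) [GrpObj K] [IsAffine K.left] [Module.Finite R (Alg K)] (κ : K ⟶ G) [IsMonHom κ] [IsClosedImmersion κ.left]
    (hK : ∀ ⦃T : SchemeOver R⦄ (t : T ⟶ G), (∃ s : T ⟶ K, s ≫ κ = t) ↔ t ≫ f = 1) :
    Module.finrank R (Alg K) = n := by
  haveI : Mono κ := Over.mono_of_mono_left κ
  exact finrank_alg_eq_of_points_iff_of_finrank_ker_eq f hn κ hK

end Literature.AlgebraicGeometry.GroupSchemes

end
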